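import Mathlib
import Literature.Analysis.Convexity.OpenHPolytopeNormalForm
import HarnessLib

/-!
# Contacts of two disjoint open polytopes of `ℝ³`: the facet-to-facet contact set

Topic `Literature/Analysis/Convexity`; namespace `Literature.Analysis.Convexity`.  For two disjoint
nonempty open polytopes `A = ⋂_{JA} {⟪c.1,·⟫ < c.2}`, `B = ⋂_{JB} {…}` (unit normal forms) and a
constraint `c ∈ JA` with chart `Φ_c`:
* `disjoint_openFacet_of_disjoint` — open facets of one plane relative to two disjoint polytopes are
  disjoint; `openFacet_subset_openHPolytope_of_not_mem`;
* `volume_contact_diff_eq_zero` — the part of the open facet of `c` inside `closure B` agrees a.e. with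
  its part inside the open facet of `B` for the opposite constraint `(-c.1, -c.2)`;
* `volume_contact_eq` — when `(-c.1, -c.2) ∈ JB`, that facet-to-facet contact has the full chart area of
  `closure A ∩ closure B`.
These are the cancellation/bookkeeping inputs of the union facet formula (stub_polytopeCalculus (B),
stmt-Ventures-19483, cell `crystal3d-full`).
[cite: EvansGariepy2015, Thm 5.16 (Gauss–Green), polyhedral case; Rockafellar1970, §6 Thm 6.3 — plumbing]
-/

noncomputable section

namespace Literature.Analysis.Convexity

open _root_.MeasureTheory Set
open scoped RealInnerProductSpace Topology
open Literature.MeasureTheory.Integral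

/-- Open facets of one plane `⟪e.1, ·⟫ = e.2` relative to two DISJOINT open polytopes are disjoint
(a common point could be pushed into both polytopes along `-e.1`).
[cite: Rockafellar1970, §6 Thm 6.3 — plumbing] -/
theorem disjoint_openFacet_of_disjoint (J J' : Finset (EuclideanSpace ℝ (Fin 3) × ℝ))
    (e : EuclideanSpace ℝ (Fin 3) × ℝ) (he : e.1 ≠ 0)
    (hQQ' : Disjoint (⋂ c ∈ J, {x : EuclideanSpace ℝ (Fin 3) | ⟪c.1, x⟫ < c.2})
      (⋂ c ∈ J', {x : EuclideanSpace ℝ (Fin 3) | ⟪c.1, x⟫ < c.2})) :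
    Disjoint {x : EuclideanSpace ℝ (Fin 3) | ⟪e.1, x⟫ = e.2 ∧ ∀ c ∈ J, c ≠ e → ⟪c.1, x⟫ < c.2}
      {x : EuclideanSpace ℝ (Fin 3) | ⟪e.1, x⟫ = e.2 ∧ ∀ c ∈ J', c ≠ e → ⟪c.1, x⟫ < c.2} := by
  rw [Set.disjoint_left]
  intro x hx hx'
  -- the two strict parts are open neighbourhoods of `x`
  have hO : IsOpen (⋂ c ∈ J.erase e, {x : EuclideanSpace ℝ (Fin 3) | ⟪c.1, x⟫ < c.2}) :=
    isOpen_openHPolytope (J.erase e)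
  have hO' : IsOpen (⋂ c ∈ J'.erase e, {x : EuclideanSpace ℝ (Fin 3) | ⟪c.1, x⟫ < c.2}) :=
    isOpen_openHPolytope (J'.erase e)
  have hxO : x ∈ ⋂ c ∈ J.erase e, {x : EuclideanSpace ℝ (Fin 3) | ⟪c.1, x⟫ < c.2} := by
    simp only [mem_iInter, mem_setOf_eq, Finset.mem_erase]
    exact fun c hc => hx.2 c hc.2 hc.1
  have hxO' : x ∈ ⋂ c ∈ J'.erase e, {x : EuclideanSpace ℝ (Fin 3) | ⟪c.1, x⟫ < c.2} := by
    simp only [mem_iInter, mem_setOf_eq, Finset.mem_erase]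
    exact fun c hc => hx'.2 c hc.2 hc.1
  obtain ⟨r, hr, hball⟩ := Metric.isOpen_iff.1 hO x hxO
  obtain ⟨r', hr', hball'⟩ := Metric.isOpen_iff.1 hO' x hxO'
  have hepos : 0 < ‖e.1‖ := norm_pos_iff.2 he
  set t : ℝ := min r r' / (2 * ‖e.1‖) with ht
  have htpos : 0 < t := by rw [ht]; positivity
  set z : EuclideanSpace ℝ (Fin 3) := x - t • e.1 with hz
  have hdist : dist z x = t * ‖e.1‖ := by
    rw [hz, dist_eq_norm, sub_sub_cancel_left, norm_neg, norm_smul, Real.norm_eq_abs,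
      abs_of_pos htpos]
  have htr : t * ‖e.1‖ = min r r' / 2 := by rw [ht]; field_simp
  have hzr : z ∈ Metric.ball x r := by
    rw [Metric.mem_ball, hdist, htr]; linarith [min_le_left r r']
  have hzr' : z ∈ Metric.ball x r' := by
    rw [Metric.mem_ball, hdist, htr]; linarith [min_le_right r r']
  have hze : ⟪e.1, z⟫ < e.2 := by
    rw [hz, inner_sub_right, inner_smul_right, hx.1, real_inner_self_eq_norm_sq]
    nlinarith [mul_pos htpos (pow_pos hepos 2)]
  have hmem : ∀ (J₀ : Finset (EuclideanSpace ℝ (Fin 3) × ℝ)),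
      z ∈ (⋂ c ∈ J₀.erase e, {x : EuclideanSpace ℝ (Fin 3) | ⟪c.1, x⟫ < c.2}) →
      z ∈ ⋂ c ∈ J₀, {x : EuclideanSpace ℝ (Fin 3) | ⟪c.1, x⟫ < c.2} := by
    intro J₀ hzO
    simp only [mem_iInter, mem_setOf_eq, Finset.mem_erase] at hzO ⊢
    intro c hc
    by_cases hce : c = e
    · rw [hce]; exact hze
    · exact hzO c ⟨hce, hc⟩
  exact Set.disjoint_left.1 hQQ' (hmem J (hball hzr)) (hmem J' (hball' hzr'))

/-- If `e` is NOT a constraint of `J`, the "open facet" of `e` relative to `J` lies in the open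
polytope of `J` itself. [cite: Rockafellar1970, §6 Thm 6.3 — plumbing] -/
theorem openFacet_subset_openHPolytope_of_not_mem (J : Finset (EuclideanSpace ℝ (Fin 3) × ℝ))
    {e : EuclideanSpace ℝ (Fin 3) × ℝ} (he : e ∉ J) :
    {x : EuclideanSpace ℝ (Fin 3) | ⟪e.1, x⟫ = e.2 ∧ ∀ c ∈ J, c ≠ e → ⟪c.1, x⟫ < c.2} ⊆
      ⋂ c ∈ J, {x : EuclideanSpace ℝ (Fin 3) | ⟪c.1, x⟫ < c.2} := by
  intro x hx
  simp only [mem_iInter, mem_setOf_eq]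
  intro c hc
  exact hx.2 c hc (fun h => he (h ▸ hc))

/-- **The facet-to-facet contact exhausts the contact** (up to a null set).  For disjoint nonempty
open polytopes `A = ⋂_{JA} {<}`, `B = ⋂_{JB} {<}` with unit normals and a constraint `c ∈ JA`, the
part of the open facet of `c` lying in `closure B` agrees a.e. (in the chart of `c`) with its part
lying in the open facet of `B` for the opposite constraint `(-c.1, -c.2)`.
[cite: EvansGariepy2015, Thm 5.16 (Gauss–Green), polyhedral case — plumbing] -/
theorem volume_contact_diff_eq_zero (JA JB : Finset (EuclideanSpace ℝ (Fin 3) × ℝ))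
    (hA1 : ∀ c ∈ JA, ‖c.1‖ = 1) (hB1 : ∀ c ∈ JB, ‖c.1‖ = 1)
    (hAne : (⋂ c ∈ JA, {x : EuclideanSpace ℝ (Fin 3) | ⟪c.1, x⟫ < c.2}).Nonempty)
    (hBne : (⋂ c ∈ JB, {x : EuclideanSpace ℝ (Fin 3) | ⟪c.1, x⟫ < c.2}).Nonempty)
    (hAB : Disjoint (⋂ c ∈ JA, {x : EuclideanSpace ℝ (Fin 3) | ⟪c.1, x⟫ < c.2})
      (⋂ c ∈ JB, {x : EuclideanSpace ℝ (Fin 3) | ⟪c.1, x⟫ < c.2}))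
    {c : EuclideanSpace ℝ (Fin 3) × ℝ} (hc : c ∈ JA) (U V : EuclideanSpace ℝ (Fin 3))
    (hU1 : ‖U‖ = 1) (hV1 : ‖V‖ = 1) (hUV : ⟪U, V⟫ = 0) (haU : ⟪c.1, U⟫ = 0) (haV : ⟪c.1, V⟫ = 0) :
    volume ((fun y : ℝ × ℝ => c.2 • c.1 + y.1 • U + y.2 • V) ⁻¹'
        ({x | ⟪c.1, x⟫ = c.2 ∧ ∀ c' ∈ JA, c' ≠ c → ⟪c'.1, x⟫ < c'.2} ∩
          closure (⋂ c ∈ JB, {x : EuclideanSpace ℝ (Fin 3) | ⟪c.1, x⟫ < c.2})) \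
      (fun y : ℝ × ℝ => c.2 • c.1 + y.1 • U + y.2 • V) ⁻¹'
        ({x | ⟪c.1, x⟫ = c.2 ∧ ∀ c' ∈ JA, c' ≠ c → ⟪c'.1, x⟫ < c'.2} ∩
          {x | ⟪-c.1, x⟫ = -c.2 ∧ ∀ c' ∈ JB, c' ≠ (-c.1, -c.2) → ⟪c'.1, x⟫ < c'.2})) = 0 := by
  classical
  have hclB := closure_openHPolytope_eq JB hBne
  -- the two null sets
  set N₁ : Set (ℝ × ℝ) := ⋃ c' ∈ JB.filter (fun c' => ¬ ∃ μ : ℝ, c'.1 = μ • c.1 ∧ c'.2 = μ * c.2),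
      (fun y : ℝ × ℝ => c.2 • c.1 + y.1 • U + y.2 • V) ⁻¹' {x : EuclideanSpace ℝ (Fin 3) | ⟪c'.1, x⟫ = c'.2}
    with hN₁
  set N₂ : Set (ℝ × ℝ) := {y : ℝ × ℝ | c ∈ JB} ∩
      (fun y : ℝ × ℝ => c.2 • c.1 + y.1 • U + y.2 • V) ⁻¹'
        (closure (⋂ c ∈ JA, {x : EuclideanSpace ℝ (Fin 3) | ⟪c.1, x⟫ < c.2}) ∩
          closure (⋂ c ∈ JB, {x : EuclideanSpace ℝ (Fin 3) | ⟪c.1, x⟫ < c.2})) with hN₂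
  have hN₁0 : volume N₁ = 0 := by
    refine (measure_biUnion_null_iff (JB.filter _).countable_toSet).2 fun c' hc' => ?_
    exact volume_chartPreimage_plane_eq_zero c c' U V (hA1 c hc) hU1 hV1 hUV haU haV
      (Finset.mem_filter.1 hc').2
  have hN₂0 : volume N₂ = 0 := by
    by_cases hcB : c ∈ JB
    · have : N₂ = (fun y : ℝ × ℝ => c.2 • c.1 + y.1 • U + y.2 • V) ⁻¹'
          (closure (⋂ c ∈ JA, {x : EuclideanSpace ℝ (Fin 3) | ⟪c.1, x⟫ < c.2}) ∩
            closure (⋂ c ∈ JB, {x : EuclideanSpace ℝ (Fin 3) | ⟪c.1, x⟫ < c.2})) := by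
        rw [hN₂]; ext y; simp [hcB]
      rw [this]
      refine volume_chartPreimage_contact_eq_zero_of_same_side (convex_openHPolytope JA)
        (isOpen_openHPolytope JA) (convex_openHPolytope JB) (isOpen_openHPolytope JB) hAB hAne hBne
        c (hA1 c hc) U V hU1 hV1 hUV haU haV ?_ ?_
      · exact Set.biInter_subset_of_mem hc
      · exact Set.biInter_subset_of_mem hcB
    · have : N₂ = ∅ := by rw [hN₂]; ext y; simp [hcB]
      rw [this, measure_empty]
  refine measure_mono_null ?_ (measure_union_null hN₁0 hN₂0)
  intro y hy
  obtain ⟨⟨hyF, hyB⟩, hyn⟩ := hy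
  simp only [mem_preimage, mem_inter_iff, mem_setOf_eq, not_and] at hyF hyB hyn
  have hxB : (c.2 • c.1 + y.1 • U + y.2 • V) ∈ ⋂ c ∈ JB, {x : EuclideanSpace ℝ (Fin 3) | ⟪c.1, x⟫ ≤ c.2} := by
    rw [← hclB]; exact hyB
  simp only [mem_iInter, mem_setOf_eq] at hxB
  have hneg : ⟪-c.1, c.2 • c.1 + y.1 • U + y.2 • V⟫ = -c.2 := by rw [inner_neg_left, hyF.1]
  obtain ⟨c', hc', hc'ne, hlt⟩ : ∃ c' ∈ JB, c' ≠ (-c.1, -c.2) ∧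
      ¬ ⟪c'.1, c.2 • c.1 + y.1 • U + y.2 • V⟫ < c'.2 := by
    have := hyn hyF hneg
    push Not at this
    obtain ⟨c', hc', hne', hle⟩ := this
    exact ⟨c', hc', hne', not_lt.2 hle⟩
  have heq : ⟪c'.1, c.2 • c.1 + y.1 • U + y.2 • V⟫ = c'.2 := le_antisymm (hxB c' hc') (not_lt.1 hlt)
  by_cases hprop : ∃ μ : ℝ, c'.1 = μ • c.1 ∧ c'.2 = μ * c.2
  · -- `c' = c` (the case `c' = -c` is excluded): same side, so `y ∈ N₂`
    right
    obtain ⟨μ, hμ1, hμ2⟩ := hprop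
    have hμ : |μ| = 1 := by
      have := congrArg norm hμ1
      rw [norm_smul, hA1 c hc, hB1 c' hc', Real.norm_eq_abs, mul_one] at this
      exact this.symm
    rcases abs_eq (zero_le_one) |>.1 hμ with h | h
    · subst h
      rw [one_smul] at hμ1
      rw [one_mul] at hμ2
      have hc'c : c' = c := Prod.ext hμ1 hμ2
      refine ⟨?_, ?_, hyB⟩
      · show c ∈ JB
        rw [← hc'c]; exact hc'
      · rw [closure_openHPolytope_eq JA hAne]
        exact openFacet_subset_closedHPolytope JA hyF
    · subst h
      rw [neg_one_smul] at hμ1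
      rw [neg_one_mul] at hμ2
      exact absurd (Prod.ext hμ1 hμ2) hc'ne
  · left
    rw [hN₁]
    exact Set.mem_biUnion (Finset.mem_filter.2 ⟨hc', hprop⟩) heq

/-- **Exact contact area.**  For `c ∈ JA` with the opposite constraint `(-c.1, -c.2) ∈ JB` (disjoint
nonempty open polytopes with unit, pairwise non-proportional constraints), the facet-to-facet contact
set has the same chart area as the full contact `closure A ∩ closure B`.
[cite: EvansGariepy2015, Thm 5.16 (Gauss–Green), polyhedral case — plumbing] -/
theorem volume_contact_eq (JA JB : Finset (EuclideanSpace ℝ (Fin 3) × ℝ))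
    (hA1 : ∀ c ∈ JA, ‖c.1‖ = 1) (hB1 : ∀ c ∈ JB, ‖c.1‖ = 1)
    (hAnd : ∀ c ∈ JA, ∀ c' ∈ JA, c ≠ c' → ¬ ∃ μ : ℝ, c'.1 = μ • c.1 ∧ c'.2 = μ * c.2)
    (hBnd : ∀ c ∈ JB, ∀ c' ∈ JB, c ≠ c' → ¬ ∃ μ : ℝ, c'.1 = μ • c.1 ∧ c'.2 = μ * c.2)
    (hAne : (⋂ c ∈ JA, {x : EuclideanSpace ℝ (Fin 3) | ⟪c.1, x⟫ < c.2}).Nonempty)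
    (hBne : (⋂ c ∈ JB, {x : EuclideanSpace ℝ (Fin 3) | ⟪c.1, x⟫ < c.2}).Nonempty)
    {c : EuclideanSpace ℝ (Fin 3) × ℝ} (hc : c ∈ JA) (hcB : ((-c.1, -c.2) : EuclideanSpace ℝ (Fin 3) × ℝ) ∈ JB)
    (U V : EuclideanSpace ℝ (Fin 3))
    (hU1 : ‖U‖ = 1) (hV1 : ‖V‖ = 1) (hUV : ⟪U, V⟫ = 0) (haU : ⟪c.1, U⟫ = 0) (haV : ⟪c.1, V⟫ = 0) :
    volume ((fun y : ℝ × ℝ => c.2 • c.1 + y.1 • U + y.2 • V) ⁻¹'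
        ({x | ⟪c.1, x⟫ = c.2 ∧ ∀ c' ∈ JA, c' ≠ c → ⟪c'.1, x⟫ < c'.2} ∩
          {x | ⟪-c.1, x⟫ = -c.2 ∧ ∀ c' ∈ JB, c' ≠ (-c.1, -c.2) → ⟪c'.1, x⟫ < c'.2})) =
      volume ((fun y : ℝ × ℝ => c.2 • c.1 + y.1 • U + y.2 • V) ⁻¹'
        (closure (⋂ c ∈ JA, {x : EuclideanSpace ℝ (Fin 3) | ⟪c.1, x⟫ < c.2}) ∩
          closure (⋂ c ∈ JB, {x : EuclideanSpace ℝ (Fin 3) | ⟪c.1, x⟫ < c.2}))) := by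
  refine measure_congr ?_
  rw [closure_openHPolytope_eq JA hAne, closure_openHPolytope_eq JB hBne, Set.preimage_inter,
    Set.preimage_inter]
  refine Filter.EventuallyEq.inter ?_ ?_
  · exact (chartPreimage_closedHPolytope_ae_eq_openFacet JA hA1 hAnd hc U V hU1 hV1 hUV haU haV).symm
  · have hΦ : (fun y : ℝ × ℝ => c.2 • c.1 + y.1 • U + y.2 • V) =
        fun y : ℝ × ℝ => ((-c.1, -c.2) : EuclideanSpace ℝ (Fin 3) × ℝ).2 •
          ((-c.1, -c.2) : EuclideanSpace ℝ (Fin 3) × ℝ).1 + y.1 • U + y.2 • V := by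
      funext y; rw [neg_smul_neg]
    rw [hΦ]
    refine (chartPreimage_closedHPolytope_ae_eq_openFacet JB hB1 hBnd hcB U V hU1 hV1 hUV ?_ ?_).symm
    · show ⟪-c.1, U⟫ = 0
      rw [inner_neg_left, haU, neg_zero]
    · show ⟪-c.1, V⟫ = 0
      rw [inner_neg_left, haV, neg_zero]


end Literature.Analysis.Convexity

end
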